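import Summits.Ventures.QEC.CircuitDistance.ETowerGeo
import Summits.Ventures.QEC.Census.FoldDriver
import HarnessLib

/-!
# P3-PORT STEP 2 (E-fold tower): TRANSLATIONS on `k` blocks, fold equivariance, kernel invariance from ROW-SPACE data
# (CARD-7 §5 S4, crit-1 PORT NOTE N1, PORT-SPEC S4/N1; cell `qec`, experiment CDX, seat qec-cdx-type-1; twin of `Census.FoldTrans`)

`transIdx l m da db` (Census) acts block-wise and is block-agnostic; here the word map `transWK` on `nb·lm` bits with the
twins of the `FoldTrans` facts (range, additivity, composition, inverse, weight, `MatchedK`, the matcher bridge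
`matchedK_of_matchRep`), FOLD EQUIVARIANCE `foldWK_transWK`, the partner map as the translation by the fibre generator, and
— replacing the Census entrywise column equivariance `TCode.ColEquiv`, which FAILS on the annihilator rows of the V-extended
tables — KERNEL INVARIANCE FROM ROW-SPACE INVARIANCE AS DATA (crit-1 N1): `QId col l m n da db Q` says
`col (transIdx da db J) = Q · col J` for an explicit 0/1 matrix `Q` (list of row masks, `Q · v = selXor Q v`), decided per
level and torus generator on the emitted tables; then `kerK col n u ↔ kerK col n (transWK … da db u)` for all `(da, db)`
(`kerK_transWK_iff`).  Generic; no data; no `native_decide`.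
-/

namespace Summit.Ventures.QEC.CircuitDistance.ETower

open Summit.Ventures.QEC.Census Summit.Ventures.QEC.Census.Fold

/-! ## Index facts on `nb` blocks -/

/-- Block coordinate of an index below `nb·lm`. -/
theorem coord_blk_ltK {l m nb J : ℕ} (hl : 0 < l) (hm : 0 < m) (hJ : J < nb * (l * m)) : J / (l * m) < nb := by
  rw [Nat.div_lt_iff_lt_mul (Nat.mul_pos hl hm)]; exact hJ

/-- Recombined coordinates stay below `nb·lm`. -/
theorem mk_ltK {l m nb A B C : ℕ} (hA : A < nb) (hB : B < l) (hC : C < m) : A * (l * m) + B * m + C < nb * (l * m) := by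
  have hlt : B * m + C < l * m := lt_lm hB hC
  have : (A + 1) * (l * m) ≤ nb * (l * m) := Nat.mul_le_mul_right _ hA
  have e : (A + 1) * (l * m) = A * (l * m) + l * m := by ring
  omega

section Trans

variable {l m : ℕ} (hl : 0 < l) (hm : 0 < m)
include hl hm

/-- `transIdx` preserves the `nb`-block window. -/
theorem transIdx_ltK (nb da db : ℕ) {J : ℕ} (hJ : J < nb * (l * m)) : transIdx l m da db J < nb * (l * m) :=
  mk_ltK (coord_blk_ltK hl hm hJ) (Nat.mod_lt _ hl) (Nat.mod_lt _ hm)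

/-- IDENTITY (no window hypothesis needed). -/
theorem transIdx_zeroK (J : ℕ) : transIdx l m 0 0 J = J := by
  rw [transIdx_eq]
  simp only [Nat.add_zero]
  rw [Nat.mod_eq_of_lt (coord_a_lt hm hl), Nat.mod_eq_of_lt (coord_b_lt hm)]
  have := idx_decomp l m J
  omega

/-- INJECTIVITY (no window hypothesis needed). -/
theorem transIdx_injK (da db : ℕ) {J J' : ℕ} (h : transIdx l m da db J = transIdx l m da db J') : J = J' := by
  have := congrArg (transIdx l m (l - da % l) (m - db % m)) h
  rw [← transIdx_mod da db J, ← transIdx_mod da db J', transIdx_comp hl hm, transIdx_comp hl hm,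
    show l - da % l + da % l = l from Nat.sub_add_cancel (Nat.mod_lt _ hl).le,
    show m - db % m + db % m = m from Nat.sub_add_cancel (Nat.mod_lt _ hm).le,
    ← transIdx_mod l m J, ← transIdx_mod l m J', Nat.mod_self, Nat.mod_self,
    transIdx_zeroK hl hm, transIdx_zeroK hl hm] at this
  exact this

end Trans

/-! ## `transWK` -/

/-- Translation of a word on the `nb`-block torus `ℤ_l × ℤ_m` by `(da, db)`. -/
def transWK (l m nb da db u : ℕ) : ℕ := lin (fun J => 2 ^ transIdx l m da db J) (nb * (l * m)) 0 u

/-- `u` translates onto one of the listed representatives (`nb` blocks). -/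
def MatchedK (l m nb : ℕ) (reps : List ℕ) (u : ℕ) : Prop := ∃ r ∈ reps, ∃ da db, transWK l m nb da db u = r

section TransW

variable {l m : ℕ} (hl : 0 < l) (hm : 0 < m)
include hl hm

omit hl hm in
/-- `transWK` is additive. -/
theorem transWK_xor (nb da db u v : ℕ) :
    transWK l m nb da db (u ^^^ v) = transWK l m nb da db u ^^^ transWK l m nb da db v := lin_xor _ _ _ _ _

/-- `transWK` stays in the window. -/
theorem transWK_lt (nb da db u : ℕ) : transWK l m nb da db u < 2 ^ (nb * (l * m)) :=
  lin_lt_two_pow _ _ _ (fun _ hJ => Nat.pow_lt_pow_right (by norm_num) (transIdx_ltK hl hm nb da db hJ)) u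

omit hl hm in
/-- `transWK` of a unit vector. -/
theorem transWK_two_pow (nb da db : ℕ) {J : ℕ} (hJ : J < nb * (l * m)) :
    transWK l m nb da db (2 ^ J) = 2 ^ transIdx l m da db J := by
  rw [transWK, lin_two_pow _ _ 0 J hJ, Nat.zero_add]

/-- Weight invariance. -/
theorem popc_transWK (nb da db u : ℕ) : popc (nb * (l * m)) (transWK l m nb da db u) = popc (nb * (l * m)) u :=
  popc_lin_pow_inj _ _ _ _ (fun _ _ _ _ h => transIdx_injK hl hm da db h) (fun _ hk => transIdx_ltK hl hm nb da db hk)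

/-- Composition of word translations. -/
theorem transWK_transWK (nb da db da' db' u : ℕ) :
    transWK l m nb da db (transWK l m nb da' db' u) = transWK l m nb (da + da') (db + db') u := by
  rw [transWK, transWK, lin_lin, transWK]
  exact lin_congr (i0 := 0) (fun J hJ => by
    rw [Nat.zero_add, lin_two_pow _ _ 0 _ (transIdx_ltK hl hm nb da' db' hJ), Nat.zero_add, transIdx_comp hl hm]) u

omit hl hm in
/-- Periodicity. -/
theorem transWK_mod (nb da db u : ℕ) : transWK l m nb (da % l) (db % m) u = transWK l m nb da db u :=
  lin_congr (i0 := 0) (fun J _ => by rw [transIdx_mod]) u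

/-- The identity translation (reads the low `nb·lm` bits). -/
theorem transWK_zero_eq_mod (nb u : ℕ) : transWK l m nb 0 0 u = u % 2 ^ (nb * (l * m)) := by
  rw [transWK, lin_congr (i0 := 0) (h := fun J => 2 ^ J) (fun J _ => by rw [Nat.zero_add, transIdx_zeroK hl hm]) u,
    lin_pow_self]

/-- The identity translation on the window. -/
theorem transWK_zero (nb : ℕ) {u : ℕ} (hu : u < 2 ^ (nb * (l * m))) : transWK l m nb 0 0 u = u := by
  rw [transWK_zero_eq_mod hl hm, Nat.mod_eq_of_lt hu]

/-- Undoing a translation. -/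
theorem transWK_inv (nb : ℕ) {u : ℕ} (hu : u < 2 ^ (nb * (l * m))) (da db : ℕ) :
    transWK l m nb (l - da % l) (m - db % m) (transWK l m nb da db u) = u := by
  rw [← transWK_mod nb da db u, transWK_transWK hl hm,
    show l - da % l + da % l = l from Nat.sub_add_cancel (Nat.mod_lt _ hl).le,
    show m - db % m + db % m = m from Nat.sub_add_cancel (Nat.mod_lt _ hm).le,
    ← transWK_mod (l := l) (m := m) nb l m u, Nat.mod_self, Nat.mod_self, transWK_zero hl hm nb hu]

/-- `MatchedK` is closed under un-translating. -/
theorem matchedK_of_matchedK_transWK {nb : ℕ} {reps : List ℕ} {da db u : ℕ}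
    (h : MatchedK l m nb reps (transWK l m nb da db u)) : MatchedK l m nb reps u := by
  obtain ⟨r, hr, da', db', h⟩ := h
  exact ⟨r, hr, da' + da, db' + db, by rw [← transWK_transWK hl hm, h]⟩

/-- Bits of a translated word. -/
theorem testBit_transWK (nb da db u : ℕ) {J : ℕ} (hJ : J < nb * (l * m)) :
    (transWK l m nb da db u).testBit (transIdx l m da db J) = u.testBit J := by
  rw [transWK]
  rcases hb : u.testBit J with _ | _
  · rw [Bool.eq_false_iff]
    intro h
    obtain ⟨k, hk, huk, he⟩ := (testBit_lin_pow_iff _ _ 0 u _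
      (fun k₁ k₂ _ _ e => transIdx_injK hl hm da db (by simpa using e))).1 h
    simp only [Nat.zero_add] at he
    have := transIdx_injK hl hm da db he
    subst this
    rw [hb] at huk; exact Bool.false_ne_true huk
  · exact (testBit_lin_pow_iff _ _ 0 u _
      (fun k₁ k₂ _ _ e => transIdx_injK hl hm da db (by simpa using e))).2 ⟨J, hJ, hb, by simp⟩

end TransW

/-! ## The matcher on `nb` blocks -/

/-- `transMask` of a support list inside the `nb`-block window is the translation of its word. -/
theorem transMask_eq_transWK {l m nb da db : ℕ} {S : List ℕ} (hS : ∀ j ∈ S, j < nb * (l * m)) :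
    transMask l m da db S = transWK l m nb da db (maskOf S) := by
  rw [transMask, transWK, xorIdx_eq_lin _ _ _ hS]

/-- A match (any `zeroOK`) certifies: the empty list with `zeroOK`, or `MatchedK`. -/
theorem matchedK_of_matchRep {l m nb md : ℕ} {reps : List ℕ} {zeroOK : Bool} {S : List ℕ}
    (hS : ∀ j ∈ S, j < nb * (l * m)) (h : (matchRep l m md (repStore md reps) zeroOK S).isSome = true) :
    (S = [] ∧ zeroOK = true) ∨ MatchedK l m nb reps (maskOf S) := by
  rw [Option.isSome_iff_exists] at h
  obtain ⟨d, hd⟩ := h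
  rcases matchRep_sound (repStore_all md reps) hd with h0 | hmem
  · exact Or.inl h0
  · exact Or.inr ⟨_, hmem, d.1, d.2, by rw [← transMask_eq_transWK hS]⟩

/-! ## Fold equivariance -/

/-- FOLD EQUIVARIANCE on indices (block-agnostic; twin of `Geo.foldIdx_transIdx` without the window hypothesis). -/
theorem foldIdx_transIdxK {G : Geo} (h : G.Shape) (da db J : ℕ) :
    G.foldIdx (transIdx G.l G.m da db J) = transIdx G.ls G.ms da db (G.foldIdx J) := by
  obtain ⟨h1, h2, h3⟩ := coords_transIdx h.l_pos h.m_pos da db J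
  have hc := coords_of_mk (l := G.ls) (m := G.ms) (A := J / (G.l * G.m)) h.ls_pos h.ms_pos
    (Nat.mod_lt (J % (G.l * G.m) / G.m) h.ls_pos) (Nat.mod_lt (J % (G.l * G.m) % G.m) h.ms_pos)
  rw [Geo.foldIdx_eq, h1, h2, h3, transIdx_eq, Geo.foldIdx_eq, hc.1, hc.2.1, hc.2.2,
    Nat.mod_mod_of_dvd _ h.ls_dvd, Nat.mod_mod_of_dvd _ h.ms_dvd, Nat.mod_add_mod, Nat.mod_add_mod]

/-- FOLD EQUIVARIANCE on `nb`-block words. -/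
theorem foldWK_transWK {G : Geo} {nb : ℕ} (h : G.Shape) (hG : OKK G nb) (da db u : ℕ) :
    foldWK G nb (transWK G.l G.m nb da db u) = transWK G.ls G.ms nb da db (foldWK G nb u) := by
  have e1 : foldWK G nb (transWK G.l G.m nb da db u) =
      lin (fun k => 2 ^ G.foldIdx (transIdx G.l G.m da db k)) (nK G nb) 0 u := by
    rw [foldWK, transWK, nK, lin_lin]
    exact lin_congr (i0 := 0) (fun J hJ => by
      have := lin_two_pow (fun J => 2 ^ G.foldIdx J) (nb * (G.l * G.m)) 0 _ (transIdx_ltK h.l_pos h.m_pos nb da db hJ)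
      rw [Nat.zero_add] at this ⊢
      exact this) u
  have e2 : transWK G.ls G.ms nb da db (foldWK G nb u) =
      lin (fun k => 2 ^ transIdx G.ls G.ms da db (G.foldIdx k)) (nK G nb) 0 u := by
    rw [foldWK, map_lin_of_xor (transWK G.ls G.ms nb da db) (lin_zero _ _ _) (transWK_xor nb da db)]
    exact lin_congr (i0 := 0) (fun J hJ => by
      rw [Nat.zero_add, transWK_two_pow nb da db (hG.foldIdx_lt J hJ)]) u
  rw [e1, e2]
  exact lin_congr (i0 := 0) (fun J _ => by rw [Nat.zero_add, foldIdx_transIdxK h da db]) u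

/-- The partner map IS the translation by the fibre generator (block-agnostic twin, no window hypothesis). -/
theorem partner_eq_transIdxK {G : Geo} (hS : G.Shape) (J : ℕ) :
    G.partner J = transIdx G.l G.m G.gen.1 G.gen.2 J := by
  rw [transIdx_eq, idx_decomp G.l G.m J]
  set blk := J / (G.l * G.m)
  set a := J % (G.l * G.m) / G.m
  set b := J % (G.l * G.m) % G.m
  have ha : a < G.l := coord_a_lt hS.m_pos hS.l_pos
  have hb : b < G.m := coord_b_lt hS.m_pos
  obtain ⟨e1, e2, e3⟩ := coords_of_mk (A := blk) hS.l_pos hS.m_pos ha hb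
  unfold Geo.partner
  simp only []
  rw [show blk * (G.l * G.m) + (a * G.m + b) = blk * (G.l * G.m) + a * G.m + b from by ring, e1, e2, e3, Geo.gen_fst,
    Geo.gen_snd]
  cases G.ax <;> simp [Nat.mod_eq_of_lt ha, Nat.mod_eq_of_lt hb]

/-- The generator acts trivially on the small `nb`-block torus. -/
theorem transWK_gen_small {G : Geo} (hS : G.Shape) (nb : ℕ) {v : ℕ} (hv : v < 2 ^ (nb * (G.ls * G.ms))) :
    transWK G.ls G.ms nb G.gen.1 G.gen.2 v = v := by
  have h1 : G.gen.1 % G.ls = 0 := by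
    rw [Geo.gen_fst]; have := hS.ax_even
    cases hax : G.ax
    · simp
    · simp only [if_true]; unfold Geo.ls; rw [if_pos hax]; exact Nat.mod_self _
  have h2 : G.gen.2 % G.ms = 0 := by
    rw [Geo.gen_snd]; have := hS.ax_even
    cases hax : G.ax
    · simp only [Bool.false_eq_true, if_false]; unfold Geo.ms; rw [if_neg (by simp [hax])]; exact Nat.mod_self _
    · simp
  rw [← transWK_mod, h1, h2, transWK_zero hS.ls_pos hS.ms_pos nb hv]

/-- Translating by the generator moves the section placement to the partner placement. -/
theorem transWK_gen_embWK {G : Geo} {nb : ℕ} (hS : G.Shape) (hG : OKK G nb) (y : ℕ) :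
    transWK G.l G.m nb G.gen.1 G.gen.2 (embWK G nb y) = parWK G nb y := by
  rw [embWK, map_lin_of_xor (transWK G.l G.m nb G.gen.1 G.gen.2) (lin_zero _ _ _) (transWK_xor _ _ _), parWK]
  exact lin_congr (i0 := 0) (fun j hj => by
    rw [Nat.zero_add, transWK_two_pow _ _ _ (hG.emb_lt j hj), ← partner_eq_transIdxK hS]) y

/-- … and the partner placement to the section placement. -/
theorem transWK_gen_parWK {G : Geo} {nb : ℕ} (hS : G.Shape) (hG : OKK G nb) (y : ℕ) :
    transWK G.l G.m nb G.gen.1 G.gen.2 (parWK G nb y) = embWK G nb y := by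
  rw [parWK, map_lin_of_xor (transWK G.l G.m nb G.gen.1 G.gen.2) (lin_zero _ _ _) (transWK_xor _ _ _), embWK]
  exact lin_congr (i0 := 0) (fun j hj => by
    rw [Nat.zero_add, transWK_two_pow _ _ _ (hG.partner_lt _ (hG.emb_lt j hj)), ← partner_eq_transIdxK hS,
      hG.partner_partner _ (hG.emb_lt j hj)]) y

/-! ## Kernel invariance from row-space invariance data (crit-1 N1) -/

/-- ROW-SPACE INVARIANCE AS DATA: translating a column index by `(da, db)` multiplies the column by the 0/1 matrix `Q`
(row masks; `Q · v = selXor Q v`).  Decided per level and torus generator on the emitted column tables (`qId_check_iff`). -/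
def QId (col : ℕ → ℕ) (l m n da db : ℕ) (Q : List ℕ) : Prop :=
  ∀ J, J < n → col (transIdx l m da db J) = selXor Q (col J)

/-- The Bool form of `QId`. -/
def qIdCheck (col : ℕ → ℕ) (l m n da db : ℕ) (Q : List ℕ) : Bool :=
  (List.range n).all fun J => col (transIdx l m da db J) == selXor Q (col J)

/-- `qIdCheck` decides `QId`. -/
theorem qId_of_check {col : ℕ → ℕ} {l m n da db : ℕ} {Q : List ℕ} (h : qIdCheck col l m n da db Q = true) :
    QId col l m n da db Q := by
  intro J hJ
  unfold qIdCheck at h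
  rw [List.all_eq_true] at h
  have := h J (List.mem_range.2 hJ)
  rwa [beq_iff_eq] at this

section Ker

variable {l m : ℕ} (hl : 0 < l) (hm : 0 < m)
include hl hm

/-- Syndrome of a translated word = `Q` applied to the syndrome. -/
theorem lin_col_transWK {col : ℕ → ℕ} {nb da db : ℕ} {Q : List ℕ} (hQ : QId col l m (nb * (l * m)) da db Q) (u : ℕ) :
    lin col (nb * (l * m)) 0 (transWK l m nb da db u) = selXor Q (lin col (nb * (l * m)) 0 u) := by
  rw [transWK, lin_lin, map_lin_of_xor (selXor Q) (selXor_zero Q) (selXor_xor Q)]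
  exact lin_congr (i0 := 0) (fun J hJ => by
    rw [Nat.zero_add, lin_two_pow _ _ 0 _ (transIdx_ltK hl hm nb da db hJ), Nat.zero_add, hQ J hJ]) u

/-- One translation with row-space data preserves the kernel. -/
theorem kerK_transWK_of_qId {col : ℕ → ℕ} {nb da db : ℕ} {Q : List ℕ} (hQ : QId col l m (nb * (l * m)) da db Q)
    {u : ℕ} (hu : kerK col (nb * (l * m)) u) : kerK col (nb * (l * m)) (transWK l m nb da db u) := by
  unfold kerK at hu ⊢
  rw [lin_col_transWK hl hm hQ, hu, selXor_zero]

/-- The identity translation preserves the kernel (it reads the word modulo the window). -/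
theorem kerK_transWK_zero {col : ℕ → ℕ} {nb u : ℕ} (hu : kerK col (nb * (l * m)) u) :
    kerK col (nb * (l * m)) (transWK l m nb 0 0 u) := by
  unfold kerK at hu ⊢
  rw [transWK_zero_eq_mod hl hm, lin_mod, hu]

/-- All translations preserve the kernel, from the data for the two torus generators. -/
theorem kerK_transWK_of_gens {col : ℕ → ℕ} {nb : ℕ} {Qx Qy : List ℕ}
    (hx : QId col l m (nb * (l * m)) 1 0 Qx) (hy : QId col l m (nb * (l * m)) 0 1 Qy) :
    ∀ (da db u : ℕ), kerK col (nb * (l * m)) u → kerK col (nb * (l * m)) (transWK l m nb da db u) := by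
  intro da
  induction da with
  | zero =>
    intro db
    induction db with
    | zero => intro u hu; exact kerK_transWK_zero hl hm hu
    | succ db ih =>
      intro u hu
      rw [show (0 : ℕ) = 0 + 0 from rfl, show db + 1 = 1 + db from Nat.add_comm _ _, ← transWK_transWK hl hm]
      exact kerK_transWK_of_qId hl hm hy (ih u hu)
  | succ da ih =>
    intro db u hu
    rw [show da + 1 = 1 + da from Nat.add_comm _ _, show db = 0 + db from (Nat.zero_add _).symm, ← transWK_transWK hl hm]
    exact kerK_transWK_of_qId hl hm hx (ih db u hu)

/-- **KERNEL INVARIANCE** under every translation, from the generator data (both directions on the window). -/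
theorem kerK_transWK_iff {col : ℕ → ℕ} {nb : ℕ} {Qx Qy : List ℕ}
    (hx : QId col l m (nb * (l * m)) 1 0 Qx) (hy : QId col l m (nb * (l * m)) 0 1 Qy)
    (da db : ℕ) {u : ℕ} (hu : u < 2 ^ (nb * (l * m))) :
    kerK col (nb * (l * m)) u ↔ kerK col (nb * (l * m)) (transWK l m nb da db u) := by
  refine ⟨kerK_transWK_of_gens hl hm hx hy da db u, fun h => ?_⟩
  have := kerK_transWK_of_gens hl hm hx hy (l - da % l) (m - db % m) _ h
  rwa [transWK_inv hl hm nb hu] at this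

end Ker

end Summit.Ventures.QEC.CircuitDistance.ETower
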